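import Mathlib.Analysis.SpecialFunctions.Pow.Real
import Literature.Analysis.FluidPDE.CheskidovForces
import Literature.Analysis.FunctionSpaces.TorusHolderBridge
import Literature.Analysis.FunctionSpaces.TorusPeriodization
import HarnessLib

/-!
# Cheskidov's time-glued family, III: from the quasi-self-similar blocks to the glued estimates
(arXiv:2311.04182, Thm. 3.1, (3.6), (6.5); Bruè–De Lellis 2023, Thm. 4.1, (4.10))

Topic `Literature/Analysis/FluidPDE` (support file for the proof of
`Literature.Analysis.FluidPDE.cheskidov_total_dissipation_family`). This file turns the clauses of
the vendored building-block fact `alberti_crippa_mazzucato_quasi_self_similar` (Cheskidov 2023,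
Thm. 3.1 / Bruè–De Lellis 2023, Thm. 4.1) into the hypotheses consumed by the gluing files and
into the estimates (3.6) on the glued profiles:

* sup-norm extraction from the `C^{j,r}` bounds of Thm. 3.1 (a) and BDL (4.10):
  `Gluing.norm_le_of_eContDiffHolderNorm_le`, `Gluing.norm_laplacian_le_of_eContDiffHolderNorm_two_le`
  (`‖Δg‖ ≤ d ‖D²(lift g)‖_∞`), assembled in `Gluing.exists_blockBounds` (an instance of
  `Gluing.BlockBounds` from clause (a) with `(α,k) ∈ {(0,0),(0,1),(2,0)}` and (4.10) with
  `α = 1/2`);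
* the glued profile inherits the block estimates (Cheskidov 2023, (3.6)): unit `L²` norm, zero
  mean, `‖∇ρ^m(t)‖_∞ ≤ Cλ_j` in the `j`-th gluing interval, and the bound on the inviscid
  enstrophy `ν∫₀^{t_{m+1}}‖∇ρ^m‖² ≤ ν C² · 2 · 25^m τ_m` ("the dissipation is dominated by the last
  term", Cheskidov 2023, proof of (4.3)), through `Gluing.sum_tau_mul_pow_le`
  (`∑_{j ≤ m} τ_j 25^j ≤ 2 · 25^m τ_m`); at `t_{m+1}` the profile is `ρ_m(1)` with
  `‖ρ_m(1)‖_{Ḣ⁻¹} ≤ Cλ_m⁻¹`.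

## References

* A. Cheskidov, arXiv:2311.04182 (2023), Thm. 3.1, (3.6), §4 (4.3), §6 (6.5).
* E. Bruè, C. De Lellis, Comm. Math. Phys. 400 (2023), Thm. 4.1 (a)–(d), (4.10).
-/

noncomputable section

open MeasureTheory Set Filter
open _root_.Topology
open scoped InnerProductSpace ContDiff ENNReal NNReal

namespace Literature.Analysis.FluidPDE.Gluing

variable {d : Type*} [Fintype d] [DecidableEq d]

/-! ## Sup norms from `C^{j,r}` norms -/

section SupNorms

variable {Y : Type*} [NormedAddCommGroup Y] [NormedSpace ℝ Y]

omit [DecidableEq d] in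
/-- A bound `‖g‖_{C^{0,r}(T^d)} ≤ M` (`M ≥ 0`) bounds `g` pointwise. [folklore] -/
theorem norm_le_of_eContDiffHolderNorm_le {g : UnitAddTorus d → Y} {r : ℝ≥0} {M : ℝ} (hM : 0 ≤ M)
    (h : FunctionSpaces.Torus.eContDiffHolderNorm 0 r g ≤ ENNReal.ofReal M) (x : UnitAddTorus d) : ‖g x‖ ≤ M := by
  have h1 : ‖g x‖ₑ ≤ ENNReal.ofReal M :=
    ((FunctionSpaces.enorm_le_eSupNorm g x).trans (FunctionSpaces.Torus.eSupNorm_le_eContDiffHolderNorm_zero g r)).trans h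
  rwa [← ofReal_norm, ENNReal.ofReal_le_ofReal_iff hM] at h1

omit [DecidableEq d] in
/-- The Laplacian is controlled by the second derivative of the lift:
`‖Δg(proj y)‖ ≤ d ‖D²(lift g)(y)‖` (`Δ = ∑ᵢ D²[eᵢ, eᵢ]`). [folklore] -/
theorem norm_laplacian_le_card_mul_norm_iteratedFDeriv (g : UnitAddTorus d → Y) (y : EuclideanSpace ℝ d) :
    ‖FunctionSpaces.Torus.laplacian g (FunctionSpaces.Torus.proj y)‖ ≤
      Fintype.card d * ‖iteratedFDeriv ℝ 2 (FunctionSpaces.Torus.lift g) y‖ := by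
  rw [← FunctionSpaces.Torus.laplacian_lift,
    InnerProductSpace.laplacian_eq_iteratedFDeriv_orthonormalBasis _ (EuclideanSpace.basisFun d ℝ)]
  refine (norm_sum_le _ _).trans ?_
  have hterm : ∀ i : d, ‖iteratedFDeriv ℝ 2 (FunctionSpaces.Torus.lift g) y
      ![(EuclideanSpace.basisFun d ℝ) i, (EuclideanSpace.basisFun d ℝ) i]‖ ≤
      ‖iteratedFDeriv ℝ 2 (FunctionSpaces.Torus.lift g) y‖ := by
    intro i
    refine (ContinuousMultilinearMap.le_opNorm _ _).trans ?_
    rw [Fin.prod_univ_two]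
    simp
  calc ∑ i, ‖iteratedFDeriv ℝ 2 (FunctionSpaces.Torus.lift g) y
        ![(EuclideanSpace.basisFun d ℝ) i, (EuclideanSpace.basisFun d ℝ) i]‖
      ≤ ∑ _i : d, ‖iteratedFDeriv ℝ 2 (FunctionSpaces.Torus.lift g) y‖ := Finset.sum_le_sum fun i _ => hterm i
    _ = Fintype.card d * ‖iteratedFDeriv ℝ 2 (FunctionSpaces.Torus.lift g) y‖ := by simp

omit [DecidableEq d] in
/-- A bound `‖g‖_{C^{2,r}(T^d)} ≤ M` (`M ≥ 0`) bounds the Laplacian pointwise by `d · M`. [folklore] -/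
theorem norm_laplacian_le_of_eContDiffHolderNorm_two_le {g : UnitAddTorus d → Y} {r : ℝ≥0} {M : ℝ}
    (hM : 0 ≤ M) (h : FunctionSpaces.Torus.eContDiffHolderNorm 2 r g ≤ ENNReal.ofReal M) (x : UnitAddTorus d) :
    ‖FunctionSpaces.Torus.laplacian g x‖ ≤ Fintype.card d * M := by
  obtain ⟨y, rfl⟩ := FunctionSpaces.Torus.proj_surjective x
  refine (norm_laplacian_le_card_mul_norm_iteratedFDeriv g y).trans (mul_le_mul_of_nonneg_left ?_ (Nat.cast_nonneg _))
  have h2 : FunctionSpaces.eSupNorm (iteratedFDeriv ℝ 2 (FunctionSpaces.Torus.lift g)) ≤ ENNReal.ofReal M := by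
    refine le_trans ?_ h
    rw [FunctionSpaces.Torus.eContDiffHolderNorm, FunctionSpaces.eContDiffHolderNorm]
    refine le_trans ?_ le_self_add
    exact Finset.single_le_sum (f := fun j => FunctionSpaces.eSupNorm (iteratedFDeriv ℝ j (FunctionSpaces.Torus.lift g)))
      (fun _ _ => zero_le) (Finset.mem_range.2 (by norm_num))
  have h3 := (FunctionSpaces.enorm_le_eSupNorm (iteratedFDeriv ℝ 2 (FunctionSpaces.Torus.lift g)) y).trans h2
  rwa [← ofReal_norm, ENNReal.ofReal_le_ofReal_iff hM] at h3

end SupNorms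

/-! ## Block bounds from the clauses of Thm. 3.1 (a) / BDL (4.10) -/

section FromBlocks

variable {v : ℕ → ℝ → UnitAddTorus d → EuclideanSpace ℝ d} {ρ : ℕ → ℝ → UnitAddTorus d → ℝ}

omit [Fintype d] [DecidableEq d] in
/-- `5^{-n}` as a real power. [folklore] -/
theorem rpow_neg_natCast_five (n : ℕ) : (5 : ℝ) ^ (-(n : ℝ)) = 1 / 5 ^ n := by
  rw [Real.rpow_neg (by norm_num), Real.rpow_natCast, one_div]

omit [Fintype d] [DecidableEq d] in
/-- `5^{-n/2} = 1/(√5)^n`. [folklore] -/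
theorem rpow_neg_half_natCast_five (n : ℕ) : (5 : ℝ) ^ (-((n : ℝ) / 2)) = 1 / Real.sqrt 5 ^ n := by
  rw [Real.rpow_neg (by norm_num), one_div, show (n : ℝ) / 2 = (1 / 2) * n by ring,
    Real.rpow_mul (by norm_num), Real.rpow_natCast, Real.sqrt_eq_rpow]

omit [Fintype d] [DecidableEq d] in
/-- Monotonicity in the constant: `ofReal (C q) ≤ ofReal (max C 0 · q)` for `q ≥ 0`. [folklore] -/
theorem ofReal_mul_le_ofReal_max_mul {C q : ℝ} (hq : 0 ≤ q) :
    ENNReal.ofReal (C * q) ≤ ENNReal.ofReal (max C 0 * q) :=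
  ENNReal.ofReal_le_ofReal (mul_le_mul_of_nonneg_right (le_max_left _ _) hq)

omit [DecidableEq d] in
/-- **Block bounds from the Hölder bounds of the building blocks** (Cheskidov 2023, Thm. 3.1 (a)
with `(α,k) ∈ {(0,0),(0,1),(2,0)}`: `‖v_n‖_∞, ‖∂ₛv_n‖_∞ ≤ Cλ_n⁻¹`, `‖Δv_n‖_∞ ≤ ‖v_n‖_{C²} ≤ Cλ_n`;
Bruè–De Lellis 2023, (4.10) with `α = 1/2`, `k = 0`: `‖v_n·∇v_n‖_∞ ≤ Cλ_n^{-1/2}`). [cite: Cheskidov2023, Thm. 3.1 (a)] -/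
theorem exists_blockBounds
    (ha : ∀ (j k : ℕ) (r : ℝ≥0), r < 1 → ∃ C : ℝ, ∀ n : ℕ, ∀ t ∈ Icc (0 : ℝ) 1,
      FunctionSpaces.Torus.eContDiffHolderNorm j r
          (fun x => iteratedDerivWithin k (fun s => v n s x) (Icc 0 1) t) ≤
        ENNReal.ofReal (C * (5 : ℝ) ^ (((j : ℝ) + r - 1) * n)))
    (ha' : ∀ (j k : ℕ) (r : ℝ≥0), r < 1 → 0 < (j : ℝ) + r → ∃ C : ℝ, ∀ n : ℕ, ∀ t ∈ Icc (0 : ℝ) 1,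
      FunctionSpaces.Torus.eContDiffHolderNorm j r
          (fun x => iteratedDerivWithin k
            (fun s => FunctionSpaces.Torus.convect (v n s) (v n s) x) (Icc 0 1) t) ≤
        ENNReal.ofReal (C * (5 : ℝ) ^ (((j : ℝ) + r - 1) * n))) :
    ∃ A : ℝ, BlockBounds v A := by
  obtain ⟨C₀, hC₀⟩ := ha 0 0 0 zero_lt_one
  obtain ⟨C₁, hC₁⟩ := ha 0 1 0 zero_lt_one
  obtain ⟨C₂, hC₂⟩ := ha 2 0 0 zero_lt_one
  obtain ⟨C₃, hC₃⟩ := ha' 0 0 (1 / 2) (by norm_num) (by norm_num)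
  set A : ℝ := max C₀ 0 + max C₁ 0 + Fintype.card d * max C₂ 0 + max C₃ 0 with hA
  have h0 : 0 ≤ max C₀ 0 := le_max_right _ _
  have h1 : 0 ≤ max C₁ 0 := le_max_right _ _
  have h2 : 0 ≤ max C₂ 0 := le_max_right _ _
  have h3 : 0 ≤ max C₃ 0 := le_max_right _ _
  have hd : (0 : ℝ) ≤ Fintype.card d := Nat.cast_nonneg _
  have hA0 : max C₀ 0 ≤ A := by rw [hA]; nlinarith
  have hA1 : max C₁ 0 ≤ A := by rw [hA]; nlinarith
  have hA2 : Fintype.card d * max C₂ 0 ≤ A := by rw [hA]; nlinarith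
  have hA3 : max C₃ 0 ≤ A := by rw [hA]; nlinarith
  refine ⟨A, ⟨by rw [hA]; nlinarith, ?_, ?_, ?_, ?_⟩⟩
  · intro n s hs x
    have h := hC₀ n s hs
    simp only [iteratedDerivWithin_zero, CharP.cast_eq_zero, NNReal.coe_zero, add_zero, zero_sub, neg_one_mul,
      rpow_neg_natCast_five] at h
    have h' := h.trans (ofReal_mul_le_ofReal_max_mul (by positivity))
    have := norm_le_of_eContDiffHolderNorm_le (by positivity) h' x
    calc ‖v n s x‖ ≤ max C₀ 0 * (1 / 5 ^ n) := this
      _ ≤ A * (1 / 5 ^ n) := mul_le_mul_of_nonneg_right hA0 (by positivity)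
      _ = A / 5 ^ n := by ring
  · intro n s hs x
    have h := hC₁ n s hs
    simp only [iteratedDerivWithin_one, CharP.cast_eq_zero, NNReal.coe_zero, add_zero, zero_sub, neg_one_mul,
      rpow_neg_natCast_five] at h
    have h' := h.trans (ofReal_mul_le_ofReal_max_mul (by positivity))
    have := norm_le_of_eContDiffHolderNorm_le (by positivity) h' x
    calc ‖FunctionSpaces.Torus.timeDerivWithin (Icc 0 1) (v n) s x‖ ≤ max C₁ 0 * (1 / 5 ^ n) := this
      _ ≤ A * (1 / 5 ^ n) := mul_le_mul_of_nonneg_right hA1 (by positivity)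
      _ = A / 5 ^ n := by ring
  · intro n s hs x
    have h := hC₂ n s hs
    simp only [iteratedDerivWithin_zero, Nat.cast_ofNat, NNReal.coe_zero, add_zero, Real.rpow_natCast,
      show (2 : ℝ) - 1 = 1 by norm_num, one_mul] at h
    have h' := h.trans (ofReal_mul_le_ofReal_max_mul (by positivity))
    have := norm_laplacian_le_of_eContDiffHolderNorm_two_le (by positivity) h' x
    calc ‖FunctionSpaces.Torus.laplacian (v n s) x‖ ≤ Fintype.card d * (max C₂ 0 * 5 ^ n) := this
      _ = Fintype.card d * max C₂ 0 * 5 ^ n := by ring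
      _ ≤ A * 5 ^ n := mul_le_mul_of_nonneg_right hA2 (by positivity)
  · intro n s hs x
    have h := hC₃ n s hs
    have hexp : (((0 : ℕ) : ℝ) + ((1 / 2 : ℝ≥0) : ℝ) - 1) * n = -((n : ℝ) / 2) := by push_cast; ring
    simp only [iteratedDerivWithin_zero, hexp, rpow_neg_half_natCast_five] at h
    have h' := h.trans (ofReal_mul_le_ofReal_max_mul (by positivity))
    have := norm_le_of_eContDiffHolderNorm_le (by positivity) h' x
    calc ‖FunctionSpaces.Torus.convect (v n s) (v n s) x‖ ≤ max C₃ 0 * (1 / Real.sqrt 5 ^ n) := this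
      _ ≤ A * (1 / Real.sqrt 5 ^ n) := mul_le_mul_of_nonneg_right hA3 (by positivity)
      _ = A / Real.sqrt 5 ^ n := by ring

end FromBlocks

/-! ## The glued profile inherits the block estimates (Cheskidov 2023, (3.6)) -/

section Profile

variable {v : ℕ → ℝ → UnitAddTorus d → EuclideanSpace ℝ d} {ρ : ℕ → ℝ → UnitAddTorus d → ℝ}
  {m : ℕ} {t : ℝ}

omit [Fintype d] [DecidableEq d] in
/-- Every `t ∈ [0, t_{m+1}]` lies in a closed gluing interval `[t_j, t_{j+1}]` with `j ≤ m`. [folklore] -/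
theorem exists_mem_Icc_tn_of_le (h0 : 0 ≤ t) (ht : t ≤ tn (m + 1)) : ∃ j ≤ m, t ∈ Icc (tn j) (tn (j + 1)) := by
  rcases lt_or_eq_of_le ht with hlt | heq
  · have ht1 : t < 1 := hlt.trans (tn_lt_one _)
    have hmem := mem_Ico_tn_blockIdx h0 ht1
    refine ⟨blockIdx t, ?_, Ico_subset_Icc_self hmem⟩
    by_contra hlt'
    push Not at hlt'
    have : tn (m + 1) ≤ tn (blockIdx t) := tn_mono (Nat.succ_le_of_lt hlt')
    linarith [hmem.1]
  · refine ⟨m, le_rfl, ?_⟩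
    rw [heq]
    exact ⟨(tn_lt_tn_succ m).le, le_rfl⟩

/-- **The glued profile keeps zero mean and unit `L²` norm up to `t_{m+1}`** (Cheskidov 2023,
Thm. 3.1 (b) block by block; (3.6)). [cite: Cheskidov2023, §3 (3.6)] -/
theorem hasZeroMean_profile_and_integral_sq (hB : Blocks ρ v)
    (hb : ∀ n : ℕ, ∀ s ∈ Icc (0 : ℝ) 1,
      FunctionSpaces.Torus.HasZeroMean (ρ n s) ∧ ∫ x, ρ n s x ^ 2 = 1 ∧ ∀ x, |ρ n s x| ≤ 10)
    (h0 : 0 ≤ t) (ht : t ≤ tn (m + 1)) :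
    FunctionSpaces.Torus.HasZeroMean (profile ρ m t) ∧ ∫ x, profile ρ m t x ^ 2 = 1 := by
  obtain ⟨j, hj, hmem⟩ := exists_mem_Icc_tn_of_le h0 ht
  rw [profile_eq_blockProfile hB hj hmem]
  have h := hb j (sigma j t) (sigma_mem_Icc j t)
  exact ⟨h.1, h.2.1⟩

/-- **Gradient bound for the glued profile**: in the `j`-th gluing interval, `j ≤ m`,
`‖∇ρ^m(t)‖_∞ ≤ Cλ_j` (Cheskidov 2023, (3.6): `‖∇ρ̃^m(t)‖_∞ ≤ Cλ_m`, block by block). [cite: Cheskidov2023, §3 (3.6)] -/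
theorem norm_gradient_profile_le (hB : Blocks ρ v) {C : ℝ}
    (hC : ∀ n : ℕ, ∀ s ∈ Icc (0 : ℝ) 1, ∀ x, ‖FunctionSpaces.Torus.gradient (ρ n s) x‖ ≤ C * 5 ^ n)
    {j : ℕ} (hj : j ≤ m) (hmem : t ∈ Icc (tn j) (tn (j + 1))) (x : UnitAddTorus d) :
    ‖FunctionSpaces.Torus.gradient (profile ρ m t) x‖ ≤ C * 5 ^ j := by
  rw [profile_eq_blockProfile hB hj hmem]
  exact hC j (sigma j t) (sigma_mem_Icc j t) x

/-- Enstrophy of the glued profile in the `j`-th gluing interval: `‖∇ρ^m(t)‖²_{L²} ≤ C² 25^j`. [cite: Cheskidov2023, §3 (3.6)] -/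
theorem scalarGradNormSq_profile_le (hB : Blocks ρ v) {C : ℝ}
    (hC : ∀ n : ℕ, ∀ s ∈ Icc (0 : ℝ) 1, ∀ x, ‖FunctionSpaces.Torus.gradient (ρ n s) x‖ ≤ C * 5 ^ n)
    {j : ℕ} (hj : j ≤ m) (hmem : t ∈ Icc (tn j) (tn (j + 1))) :
    Torus.scalarGradNormSq (profile ρ m t) ≤ C ^ 2 * 25 ^ j := by
  rw [Torus.scalarGradNormSq]
  have hpt : ∀ x, ‖FunctionSpaces.Torus.gradient (profile ρ m t) x‖ ^ 2 ≤ C ^ 2 * 25 ^ j := fun x => by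
    calc ‖FunctionSpaces.Torus.gradient (profile ρ m t) x‖ ^ 2 ≤ (C * 5 ^ j) ^ 2 :=
          pow_le_pow_left₀ (norm_nonneg _) (norm_gradient_profile_le hB hC hj hmem x) 2
      _ = C ^ 2 * 25 ^ j := by
          rw [mul_pow, show ((5 : ℝ) ^ j) ^ 2 = 25 ^ j by rw [← pow_mul, mul_comm, pow_mul]; norm_num]
  calc ∫ x, ‖FunctionSpaces.Torus.gradient (profile ρ m t) x‖ ^ 2
      ≤ ∫ _x : UnitAddTorus d, C ^ 2 * (25 : ℝ) ^ j := by
        refine integral_mono_of_nonneg (Eventually.of_forall fun x => sq_nonneg _) (integrable_const _)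
          (Eventually.of_forall hpt)
    _ = C ^ 2 * 25 ^ j := by simp

omit [Fintype d] [DecidableEq d] in
/-- **"The dissipation is dominated by the last term"** (Cheskidov 2023, proof of (4.3)):
`∑_{j ≤ m} τ_j 25^j ≤ 2 · 25^m τ_m` (the block lengths decay only polynomially,
`τ_m/τ_{m+1} = (m+3)/(m+1) ≤ 3 < 25/2`). [cite: Cheskidov2023, §4 (4.3)] -/
theorem sum_tau_mul_pow_le (m : ℕ) :
    ∑ j ∈ Finset.range (m + 1), tau j * 25 ^ j ≤ 2 * 25 ^ m * tau m := by
  induction m with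
  | zero => simp [tau]; norm_num
  | succ k ih =>
    rw [Finset.sum_range_succ]
    have h25 : (0 : ℝ) < 25 ^ k := pow_pos (by norm_num) k
    have hpoly : 2 * tau k ≤ 25 * tau (k + 1) := by
      rw [tau, tau]
      push_cast
      rw [mul_one_div, mul_one_div, div_le_div_iff₀ (by positivity) (by positivity)]
      nlinarith
    have hk : 2 * 25 ^ k * tau k ≤ 25 ^ (k + 1) * tau (k + 1) := by
      calc 2 * 25 ^ k * tau k = 25 ^ k * (2 * tau k) := by ring
        _ ≤ 25 ^ k * (25 * tau (k + 1)) := mul_le_mul_of_nonneg_left hpoly h25.le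
        _ = 25 ^ (k + 1) * tau (k + 1) := by ring
    linarith

/-- **The inviscid enstrophy up to `t_{m+1}`** (Cheskidov 2023, proof of (4.3):
`2ν∫₀ᵀ‖∇ρ^m‖² ≲ ν (T - t_m) λ_m²` for `T ∈ [t_{m+1}, 2]`): for `ν ≥ 0`,
`ν∫₀^{t_{m+1}} ‖∇ρ^m(t)‖²_{L²} dt ≤ ν C² · 2 · 25^m τ_m`. [cite: Cheskidov2023, §4 (4.3)] -/
theorem scalarDissipation_profile_le (hB : Blocks ρ v) {C : ℝ}
    (hC : ∀ n : ℕ, ∀ s ∈ Icc (0 : ℝ) 1, ∀ x, ‖FunctionSpaces.Torus.gradient (ρ n s) x‖ ≤ C * 5 ^ n)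
    {ν : ℝ} (hν : 0 ≤ ν) (m : ℕ) :
    Torus.scalarDissipation ν (profile ρ m) 0 (tn (m + 1)) ≤ ν * (C ^ 2 * (2 * 25 ^ m * tau m)) := by
  rw [Torus.scalarDissipation]
  refine mul_le_mul_of_nonneg_left ?_ hν
  -- continuity of the enstrophy, hence interval integrability
  have hcl := isClassicalScalarTransportOn_profile hB m (uniqueDiffOn_univ : UniqueDiffOn ℝ (univ : Set ℝ))
  have hcont : Continuous fun s => Torus.scalarGradNormSq (profile ρ m s) :=
    continuousOn_univ.1 (hcl.continuousOn_scalarGradNormSq convex_univ uniqueDiffOn_univ)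
  have hint : ∀ a b : ℝ, IntervalIntegrable (fun s => Torus.scalarGradNormSq (profile ρ m s)) volume a b :=
    fun a b => hcont.intervalIntegrable a b
  have hsum := intervalIntegral.sum_integral_adjacent_intervals (a := tn) (n := m + 1) fun k _ => hint (tn k) (tn (k + 1))
  rw [tn_zero] at hsum
  rw [← hsum]
  have hblock : ∀ j ∈ Finset.range (m + 1),
      ∫ s in tn j..tn (j + 1), Torus.scalarGradNormSq (profile ρ m s) ≤ C ^ 2 * (tau j * 25 ^ j) := by
    intro j hj
    have hjm : j ≤ m := Nat.lt_succ_iff.1 (Finset.mem_range.1 hj)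
    calc ∫ s in tn j..tn (j + 1), Torus.scalarGradNormSq (profile ρ m s)
        ≤ ∫ _s in tn j..tn (j + 1), C ^ 2 * (25 : ℝ) ^ j := by
          refine intervalIntegral.integral_mono_on (tn_lt_tn_succ j).le (hint _ _) intervalIntegrable_const
            fun s hs => scalarGradNormSq_profile_le hB hC hjm hs
      _ = C ^ 2 * (tau j * 25 ^ j) := by rw [intervalIntegral.integral_const, tn_succ_sub, smul_eq_mul]; ring
  calc ∑ j ∈ Finset.range (m + 1), ∫ s in tn j..tn (j + 1), Torus.scalarGradNormSq (profile ρ m s)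
      ≤ ∑ j ∈ Finset.range (m + 1), C ^ 2 * (tau j * 25 ^ j) := Finset.sum_le_sum hblock
    _ = C ^ 2 * ∑ j ∈ Finset.range (m + 1), tau j * 25 ^ j := (Finset.mul_sum _ _ _).symm
    _ ≤ C ^ 2 * (2 * 25 ^ m * tau m) := mul_le_mul_of_nonneg_left (sum_tau_mul_pow_le m) (sq_nonneg _)

/-- **The frozen profile at `t_{m+1}` is `ρ_m(1)`**, mean zero with `‖ρ_m(1)‖_{Ḣ⁻¹} ≤ Cλ_m⁻¹`
(Cheskidov 2023, (3.6): "the density `ρ^m` stays on the highest frequency `λ_m` on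
`[t_m, t_{m+1}]`", used in (4.6)). [cite: Cheskidov2023, §3 (3.6)] -/
theorem profile_tn_succ (hB : Blocks ρ v)
    (hb : ∀ n : ℕ, ∀ s ∈ Icc (0 : ℝ) 1,
      FunctionSpaces.Torus.HasZeroMean (ρ n s) ∧ ∫ x, ρ n s x ^ 2 = 1 ∧ ∀ x, |ρ n s x| ≤ 10)
    {C : ℝ} (hH : ∀ n : ℕ, ∀ s ∈ Icc (0 : ℝ) 1,
      FunctionSpaces.Torus.eHomSobolevSeminorm (-1) (fun x => (ρ n s x : ℂ)) ≤ ENNReal.ofReal (C * (5 ^ n)⁻¹))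
    (m : ℕ) :
    profile ρ m (tn (m + 1)) = ρ m 1 ∧ FunctionSpaces.Torus.HasZeroMean (ρ m 1) ∧
      FunctionSpaces.Torus.eHomSobolevSeminorm (-1) (fun x => (ρ m 1 x : ℂ)) ≤ ENNReal.ofReal (C * (5 ^ m)⁻¹) :=
  ⟨profile_eq_of_ge hB le_rfl, (hb m 1 ⟨zero_le_one, le_rfl⟩).1, hH m 1 ⟨zero_le_one, le_rfl⟩⟩

end Profile

end Literature.Analysis.FluidPDE.Gluing

end
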